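import Summits.CriticalPhenomena.SAWScalingLimit.Theorems.SAWDevelopingMapObservableToSLETypeLadderCarvedReductionSqueezeNested
import Summits.CriticalPhenomena.SAWScalingLimit.Theorems.SAWDevelopingMapObservableToSLETypeLadderCarvedReductionSqueezeCells
import Summits.CriticalPhenomena.SAWScalingLimit.Theorems.SAWDefectDecoherenceObservableToSLERGateDefs
import Literature.Probability.RandomPlanarGeometry.HullSubdomainPullback
import Literature.Probability.RandomPlanarGeometry.ConformalRectangle
import HarnessLib

/-!
# The LATTICE HALF of the geometry of the moving-carving squeeze (piece (T-A lat) of stub T-A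
# `stub_carvedReduction_squeezeGeometry`)

Crux `SAWDevelopingMap.ObservableToSLE` (stmt-CriticalPhenomena-10472), line `six-class-type-ladder`,
stub T-A `stub_carvedReduction_squeezeGeometry`.  Landing target:
`Summits/CriticalPhenomena/SAWScalingLimit/Theorems/SAWDevelopingMapObservableToSLETypeLadderCarvedReductionSqueezeLattice.lean`
(`--supports stmt-CriticalPhenomena-10472`).  Sequel of `…SqueezeNested` (p136621) and
`…SqueezeCells` (p136631).

T-A (the geometry of the squeeze) = STAGE 1 (the continuum geometry of the pinned frame: selection
and pinning, limit structure of the removed sets, the outer two-piece flat Jordan approximant `E`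
with gate boxes, the inner hull subdomain `M` with restriction datum `d`, `1 - ε' < d^{5/8}`, and
the boundary closeness of `M + τ` to `D`) followed by STAGE 2 = THIS FILE
(`carvedReduction_squeezeGeometry_lattice`): from the pinned data and the GEOMETRIC FACTS of the
pinned frame —
(s) the meshes along the selected subsequence are strictly decreasing, positive, `→ 0`;
(g) the realised gates are up-faces whose pinned centres converge to the marked points of `E` and sit
    STRICTLY ABOVE their heights at every index (twin piece `…SqueezePinning`, p133120);
(U) near the pinned gates the removed set is EXACTLY the rows below the gate row;
(MD) `M + τ_j` and the `2ρc`-discs about the gates lie in `D`; (MU) points of `M` off the gates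
    carry no removed vertex; (R) every vertex of a walk of `Ω_δ` from the gate avoiding the removed
    set is, pinned, CLEARLY DEEP in `E`; the gate is a vertex of `Ω_δ`; the carved laws are
    probability measures —
it produces VERBATIM the conclusion of the registered T-A: the subsequence (shifted past the index
where everything holds), the family block of `M`, the cells, and the squeeze package (thresholds
spliced from the pinned gate rows, `…SqueezeThresholds` p136160; nested families `…SqueezeNested`;
cells `…SqueezeCells`).  Registered carrier: `stub_carvedReduction_upFace_eq`.
-/

noncomputable section

open scoped BigOperators Topology NNReal ENNReal Classical
open Filter Set MeasureTheory Metric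
open Literature.Probability.LatticeModels (HexVertex hexGraph hexCenter triZeta triEmbed Site polyline)
open Literature.Probability.RandomPlanarGeometry
open Literature.Probability.RandomPlanarGeometry.SAW
open Literature.Probability.Percolation (PathIn)
open UpperHalfPlane (upperHalfPlaneSet)

namespace Summit.CriticalPhenomena.SAWScalingLimit.Theorems.ObservableToSLE.TypeLadder

open Summit.CriticalPhenomena.SAWScalingLimit.Theorems.ObservableToSLER.BridgeGate

/-! ### Small helpers -/

/-- An up-face is determined by its cell. -/
theorem upFace_eq {v : HexVertex} (hv : v.2 = 0) (y : Site 2) (hy : v.1 = y) :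
    v = ((y, 0) : HexVertex) := by
  obtain ⟨c, k⟩ := v
  simp only at hv hy
  subst hy; subst hv; rfl

/-- **Registered sub-goal `stub_carvedReduction_upFace_eq`** (crux item stmt-CriticalPhenomena-10472,
stub T-A `stub_carvedReduction_squeezeGeometry`, piece (T-A lat)): an up-face is the up-face of its
cell translated back and forth. -/
theorem stub_carvedReduction_upFace_eq :
    ∀ (v : HexVertex) (x : Site 2), v.2 = 0 → v = ((x + (v.1 - x), 0) : HexVertex) :=
  fun v x hv => upFace_eq hv _ (by abel)

/-! ### Stage 2 -/

/-- **STAGE 2 OF T-A (the lattice half)**; see the module docstring. -/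
theorem carvedReduction_squeezeGeometry_lattice (D : DobrushinDomain) (δ : ℕ → ℝ)
    (S T : ℕ → ℕ → Set HexVertex) (n n' : ℕ → ℕ) (q q' : ℕ → HexVertex) (η ε' : ℝ) (φ ψ₀ : ℕ → ℕ)
    (E M : DobrushinDomain) (τ : ℂ) (x : ℕ → Site 2) (φE : ConformalEquiv upperHalfPlaneSet E.carrier)
    (Φ : ConformalEquiv (upperHalfPlaneSet \ φE.pullbackHull M) upperHalfPlaneSet) (d : ℝ)
    (ρw ρc ρc' ρF : ℝ)
    (hψ₀ : StrictMono ψ₀) (hsanti : StrictAnti fun j => δ (φ (ψ₀ j))) (hspos : ∀ j, 0 < δ (φ (ψ₀ j)))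
    (hs0 : Tendsto (fun j => δ (φ (ψ₀ j))) atTop (𝓝[>] 0))
    (hτ : Tendsto (fun j => ((δ (φ (ψ₀ j)) : ℝ) : ℂ) * triEmbed (x j)) atTop (𝓝 τ))
    (hM : E.IsHullSubdomain M)
    (hbd : ∀ t : ℝ, dist (M.boundary t + τ) (D.boundary t) ≤ η)
    (hbd0 : dist (M.pt 0 + τ) (D.pt 0) ≤ η) (hbd1 : dist (M.pt 1 + τ) (D.pt 1) ≤ η)
    (hflat : ∀ i, E.carrier ∩ ball (E.pt i) ρw = {z : ℂ | (E.pt i).im < z.im} ∩ ball (E.pt i) ρw)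
    (hB : ∀ i (z : ℂ), |z.re - (E.pt i).re| ≤ ρc → (E.pt i).im - ρc' ≤ z.im → z.im ≤ (E.pt i).im →
      z ∉ E.carrier)
    (hρc : 0 < ρc) (hρc' : 0 < ρc') (hρF : 0 < ρF) (hFc : ρF ≤ ρc) (hFc' : ρF ≤ ρc') (hFw : ρF ≤ ρw)
    (hsep : 2 * (ρc + ρc') + ρF ≤ dist (E.pt 0) (E.pt 1))
    (hφE : E.IsChordalUniformizing φE) (hΦ : IsRestrictionMap (φE.pullbackHull M) Φ)
    (hd : HasRestrictionDeriv (φE.pullbackHull M) Φ d) (hlev : 1 - ε' < d ^ ((5 : ℝ) / 8))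
    -- (g) the pinned gates
    (hq0 : ∀ j, (q (φ (ψ₀ j))).2 = 0) (hq1 : ∀ j, (q' (φ (ψ₀ j))).2 = 0)
    (hconv0 : Tendsto (fun j => ((δ (φ (ψ₀ j)) : ℝ) : ℂ) *
      hexCenter (((q (φ (ψ₀ j))).1 - x j, 0) : HexVertex)) atTop (𝓝 (E.pt 0)))
    (hconv1 : Tendsto (fun j => ((δ (φ (ψ₀ j)) : ℝ) : ℂ) *
      hexCenter (((q' (φ (ψ₀ j))).1 - x j, 0) : HexVertex)) atTop (𝓝 (E.pt 1)))
    (habove0 : ∀ j, (E.pt 0).im <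
      (((δ (φ (ψ₀ j)) : ℝ) : ℂ) * hexCenter (((q (φ (ψ₀ j))).1 - x j, 0) : HexVertex)).im)
    (habove1 : ∀ j, (E.pt 1).im <
      (((δ (φ (ψ₀ j)) : ℝ) : ℂ) * hexCenter (((q' (φ (ψ₀ j))).1 - x j, 0) : HexVertex)).im)
    -- (U) exactness of the removed set near the pinned gates
    (hU0 : ∀ᶠ j in atTop, ∀ v : HexVertex,
      ((δ (φ (ψ₀ j)) : ℝ) : ℂ) * hexCenter v - ((δ (φ (ψ₀ j)) : ℝ) : ℂ) * triEmbed (x j) ∈ ball (E.pt 0) ρF →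
        (v ∈ S (φ (ψ₀ j)) (n (φ (ψ₀ j))) ∪ T (φ (ψ₀ j)) (n' (φ (ψ₀ j))) ↔ v.1 1 < (q (φ (ψ₀ j))).1 1))
    (hU1 : ∀ᶠ j in atTop, ∀ v : HexVertex,
      ((δ (φ (ψ₀ j)) : ℝ) : ℂ) * hexCenter v - ((δ (φ (ψ₀ j)) : ℝ) : ℂ) * triEmbed (x j) ∈ ball (E.pt 1) ρF →
        (v ∈ S (φ (ψ₀ j)) (n (φ (ψ₀ j))) ∪ T (φ (ψ₀ j)) (n' (φ (ψ₀ j))) ↔ v.1 1 < (q' (φ (ψ₀ j))).1 1))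
    -- (MD), (MU)
    (hMD : ∀ᶠ j in atTop, ∀ z : ℂ, (z ∈ M.carrier ∨ ∃ i, dist z (E.pt i) ≤ 2 * ρc) →
      z + ((δ (φ (ψ₀ j)) : ℝ) : ℂ) * triEmbed (x j) ∈ D.carrier)
    (hMU : ∀ r > (0 : ℝ), ∀ᶠ j in atTop, ∀ v : HexVertex,
      ((δ (φ (ψ₀ j)) : ℝ) : ℂ) * hexCenter v - ((δ (φ (ψ₀ j)) : ℝ) : ℂ) * triEmbed (x j) ∈ M.carrier →
        (∀ i, r ≤ dist (((δ (φ (ψ₀ j)) : ℝ) : ℂ) * hexCenter v - ((δ (φ (ψ₀ j)) : ℝ) : ℂ) * triEmbed (x j))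
          (E.pt i)) →
        v ∉ S (φ (ψ₀ j)) (n (φ (ψ₀ j))) ∪ T (φ (ψ₀ j)) (n' (φ (ψ₀ j))))
    -- (R) the reach of the gate is clearly deep in `E`
    (hreach : ∀ᶠ j in atTop, ∀ (w : HexVertex)
      (π : (hexDomainGraph D.carrier (δ (φ (ψ₀ j)))).Walk (q (φ (ψ₀ j))) w),
      (∀ y ∈ π.support, y ∉ S (φ (ψ₀ j)) (n (φ (ψ₀ j))) ∪ T (φ (ψ₀ j)) (n' (φ (ψ₀ j)))) →
        ∀ y ∈ π.support,
          ((δ (φ (ψ₀ j)) : ℝ) : ℂ) * hexCenter y - ((δ (φ (ψ₀ j)) : ℝ) : ℂ) * triEmbed (x j) ∈ E.carrier ∧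
          closedBall (((δ (φ (ψ₀ j)) : ℝ) : ℂ) * hexCenter y - ((δ (φ (ψ₀ j)) : ℝ) : ℂ) * triEmbed (x j))
              (25 * δ (φ (ψ₀ j))) ⊆ E.carrier ∪
            ⋃ i, {z : ℂ | |z.re - (E.pt i).re| ≤ ρc ∧ (E.pt i).im - 30 * δ (φ (ψ₀ j)) ≤ z.im ∧
              z.im ≤ (E.pt i).im} ∧
          (|(((δ (φ (ψ₀ j)) : ℝ) : ℂ) * hexCenter y - ((δ (φ (ψ₀ j)) : ℝ) : ℂ) * triEmbed (x j)).re -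
                (E.pt 0).re| < ρc + 10 * δ (φ (ψ₀ j)) →
            |(((δ (φ (ψ₀ j)) : ℝ) : ℂ) * hexCenter y - ((δ (φ (ψ₀ j)) : ℝ) : ℂ) * triEmbed (x j)).im -
                (E.pt 0).im| < ρc' → (q (φ (ψ₀ j))).1 1 ≤ y.1 1) ∧
          (|(((δ (φ (ψ₀ j)) : ℝ) : ℂ) * hexCenter y - ((δ (φ (ψ₀ j)) : ℝ) : ℂ) * triEmbed (x j)).re -
                (E.pt 1).re| < ρc + 10 * δ (φ (ψ₀ j)) →
            |(((δ (φ (ψ₀ j)) : ℝ) : ℂ) * hexCenter y - ((δ (φ (ψ₀ j)) : ℝ) : ℂ) * triEmbed (x j)).im -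
                (E.pt 1).im| < ρc' → (q' (φ (ψ₀ j))).1 1 ≤ y.1 1))
    (hqdom : ∀ j, q (φ (ψ₀ j)) ∈ embMeshDomain hexGraph hexCenter D.carrier (δ (φ (ψ₀ j))))
    (hprob : ∀ᶠ j in atTop, IsProbabilityMeasure (carvedLaw D.carrier (δ (φ (ψ₀ j)))
      (S (φ (ψ₀ j)) (n (φ (ψ₀ j))) ∪ T (φ (ψ₀ j)) (n' (φ (ψ₀ j)))) (q (φ (ψ₀ j))) (q' (φ (ψ₀ j))))) :
    ∃ (ψ : ℕ → ℕ) (M : DobrushinDomain) (τ : ℂ) (ρ' : ℝ) (Λ' : ℝ → Finset HexVertex)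
      (m : Fin 2 → ℝ → ℤ) (a' b' : ℝ → Sym2 HexVertex) (x : ℕ → Site 2)
      (Λ'' : ℕ → Finset HexVertex) (pu pv : ℕ → HexVertex),
      StrictMono ψ ∧
      (∀ t : ℝ, dist (M.boundary t + τ) (D.boundary t) ≤ η) ∧
      dist (M.pt 0 + τ) (D.pt 0) ≤ η ∧ dist (M.pt 1 + τ) (D.pt 1) ≤ η ∧
      (0 < ρ' ∧ ∀ i : Fin 2,
        M.carrier ∩ ball (M.pt i) ρ' = {z : ℂ | (M.pt i).im < z.im} ∩ ball (M.pt i) ρ') ∧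
      (∀ᶠ δ' : ℝ in 𝓝[>] 0, hexDomainSimplyConnected (Λ' δ') ∧
        a' δ' ∈ hexDomainBoundary (Λ' δ') ∧ b' δ' ∈ hexDomainBoundary (Λ' δ') ∧
        Nonempty (HexMidEdgeSAW (Λ' δ') (a' δ') (b' δ')) ∧
        (hexGraph.induce (↑(Λ' δ') : Set HexVertex)).Preconnected ∧
        (∀ v ∈ Λ' δ', (δ' : ℂ) * hexCenter v ∈ M.carrier) ∧
        (∀ i : Fin 2, ∀ v : HexVertex, (δ' : ℂ) * hexCenter v ∈ ball (M.pt i) ρ' →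
          (v ∈ Λ' δ' ↔ m i δ' ≤ v.1 1))) ∧
      (∀ K : Set ℂ, IsCompact K → K ⊆ M.carrier →
        ∀ᶠ δ' : ℝ in 𝓝[>] 0, ∀ v : HexVertex, (δ' : ℂ) * hexCenter v ∈ K → v ∈ Λ' δ') ∧
      Tendsto (fun δ' : ℝ => (δ' : ℂ) * hexMidpoint (a' δ')) (𝓝[>] 0) (𝓝 (M.pt 0)) ∧
      Tendsto (fun δ' : ℝ => (δ' : ℂ) * hexMidpoint (b' δ')) (𝓝[>] 0) (𝓝 (M.pt 1)) ∧
      Tendsto (fun j : ℕ => ((δ (φ (ψ j)) : ℝ) : ℂ) *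
        Literature.Probability.LatticeModels.triEmbed (x j)) atTop (𝓝 τ) ∧
      (∀ j : ℕ,
        (∀ w : HexVertex, w ∈ Λ'' j ↔ ((-(x j) + w.1, w.2) : HexVertex) ∈ Λ' (δ (φ (ψ j)))) ∧
        (∀ w ∈ Λ'' j, w ∉ S (φ (ψ j)) (n (φ (ψ j))) ∪ T (φ (ψ j)) (n' (φ (ψ j)))) ∧
        (∀ w ∈ Λ'' j, ∀ y ∈ Λ'' j, hexGraph.Adj w y →
          (hexDomainGraph D.carrier (δ (φ (ψ j)))).Adj w y) ∧
        q (φ (ψ j)) ∈ Λ'' j ∧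
        pu j ∈ S (φ (ψ j)) (n (φ (ψ j))) ∪ T (φ (ψ j)) (n' (φ (ψ j))) ∧
        pv j ∈ S (φ (ψ j)) (n (φ (ψ j))) ∪ T (φ (ψ j)) (n' (φ (ψ j))) ∧
        hexGraph.Adj (q (φ (ψ j))) (pu j) ∧
        s(q (φ (ψ j)), pu j) ≠ s(q' (φ (ψ j)), pv j) ∧
        (a' (δ (φ (ψ j)))).map (fun w : HexVertex => ((x j + w.1, w.2) : HexVertex)) =
          s(q (φ (ψ j)), pu j) ∧
        (b' (δ (φ (ψ j)))).map (fun w : HexVertex => ((x j + w.1, w.2) : HexVertex)) =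
          s(q' (φ (ψ j)), pv j)) ∧
      ∃ (E : DobrushinDomain) (ρE : ℝ) (φE : ConformalEquiv upperHalfPlaneSet E.carrier)
        (Φ : ConformalEquiv (upperHalfPlaneSet \ φE.pullbackHull M) upperHalfPlaneSet) (d : ℝ)
        (Nf : ℝ → Finset HexVertex) (m₀ m₁ m₁' : ℝ → ℤ),
        (0 < ρE ∧ ∀ i : Fin 2,
          E.carrier ∩ ball (E.pt i) ρE = {z : ℂ | (E.pt i).im < z.im} ∩ ball (E.pt i) ρE) ∧
        E.IsHullSubdomain M ∧ E.IsChordalUniformizing φE ∧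
        IsRestrictionMap (φE.pullbackHull M) Φ ∧ HasRestrictionDeriv (φE.pullbackHull M) Φ d ∧
        1 - ε' < d ^ ((5 : ℝ) / 8) ∧
        (∀ᶠ δ' : ℝ in 𝓝[>] 0,
          Λ' δ' ⊆ Nf δ' ∧ hexDomainSimplyConnected (Nf δ') ∧ hexDomainSimplyConnected (Λ' δ') ∧
          (hexGraph.induce (↑(Nf δ') : Set HexVertex)).Preconnected ∧
          (hexGraph.induce (↑(Λ' δ') : Set HexVertex)).Preconnected ∧
          a' δ' ∈ hexDomainBoundary (Nf δ') ∧ b' δ' ∈ hexDomainBoundary (Nf δ') ∧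
          a' δ' ∈ hexDomainBoundary (Λ' δ') ∧ b' δ' ∈ hexDomainBoundary (Λ' δ') ∧
          Nonempty (HexMidEdgeSAW (Λ' δ') (a' δ') (b' δ')) ∧
          (∀ w ∈ Nf δ', (δ' : ℂ) * hexCenter w ∈ E.carrier) ∧
          (∀ w ∈ Λ' δ', (δ' : ℂ) * hexCenter w ∈ M.carrier) ∧
          (∀ w : HexVertex, (δ' : ℂ) * hexCenter w ∈ ball (E.pt 0) ρE →
            ((w ∈ Nf δ' ↔ m₀ δ' ≤ w.1 1) ∧ (w ∈ Λ' δ' ↔ m₀ δ' ≤ w.1 1))) ∧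
          (∀ w : HexVertex, (δ' : ℂ) * hexCenter w ∈ ball (E.pt 1) ρE →
            ((w ∈ Nf δ' ↔ m₁ δ' ≤ w.1 1) ∧ (w ∈ Λ' δ' ↔ m₁' δ' ≤ w.1 1)))) ∧
        (∀ K : Set ℂ, IsCompact K → K ⊆ E.carrier →
          ∀ᶠ δ' : ℝ in 𝓝[>] 0, ∀ w : HexVertex, (δ' : ℂ) * hexCenter w ∈ K → w ∈ Nf δ') ∧
        (∀ K : Set ℂ, IsCompact K → K ⊆ M.carrier →
          ∀ᶠ δ' : ℝ in 𝓝[>] 0, ∀ w : HexVertex, (δ' : ℂ) * hexCenter w ∈ K → w ∈ Λ' δ') ∧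
        Tendsto (fun δ' : ℝ => (δ' : ℂ) * hexMidpoint (a' δ')) (𝓝[>] 0) (𝓝 (E.pt 0)) ∧
        Tendsto (fun δ' : ℝ => (δ' : ℂ) * hexMidpoint (b' δ')) (𝓝[>] 0) (𝓝 (E.pt 1)) ∧
        (∀ᶠ j : ℕ in atTop,
          IsProbabilityMeasure (carvedLaw D.carrier (δ (φ (ψ j)))
            (S (φ (ψ j)) (n (φ (ψ j))) ∪ T (φ (ψ j)) (n' (φ (ψ j)))) (q (φ (ψ j))) (q' (φ (ψ j)))) ∧
          (∀ w : HexVertex, w ∈ Λ'' j ↔ ((-(x j) + w.1, w.2) : HexVertex) ∈ Λ' (δ (φ (ψ j)))) ∧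
          (∀ w ∈ Λ'' j, w ∉ S (φ (ψ j)) (n (φ (ψ j))) ∪ T (φ (ψ j)) (n' (φ (ψ j)))) ∧
          (∀ w ∈ Λ'' j, ∀ y ∈ Λ'' j, hexGraph.Adj w y →
            (hexDomainGraph D.carrier (δ (φ (ψ j)))).Adj w y) ∧
          q (φ (ψ j)) ∈ Λ'' j ∧
          pu j ∈ S (φ (ψ j)) (n (φ (ψ j))) ∪ T (φ (ψ j)) (n' (φ (ψ j))) ∧
          pv j ∈ S (φ (ψ j)) (n (φ (ψ j))) ∪ T (φ (ψ j)) (n' (φ (ψ j))) ∧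
          hexGraph.Adj (q (φ (ψ j))) (pu j) ∧
          s(q (φ (ψ j)), pu j) ≠ s(q' (φ (ψ j)), pv j) ∧
          (a' (δ (φ (ψ j)))).map (fun w : HexVertex => ((x j + w.1, w.2) : HexVertex)) =
            s(q (φ (ψ j)), pu j) ∧
          (b' (δ (φ (ψ j)))).map (fun w : HexVertex => ((x j + w.1, w.2) : HexVertex)) =
            s(q' (φ (ψ j)), pv j) ∧
          (∀ (w : HexVertex) (π : (hexDomainGraph D.carrier (δ (φ (ψ j)))).Walk (q (φ (ψ j))) w),
            (∀ y ∈ π.support, y ∉ S (φ (ψ j)) (n (φ (ψ j))) ∪ T (φ (ψ j)) (n' (φ (ψ j)))) →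
              ∀ y ∈ π.support, ((-(x j) + y.1, y.2) : HexVertex) ∈ Nf (δ (φ (ψ j)))) ∧
          ((-(x j) + (pu j).1, (pu j).2) : HexVertex) ∉ Nf (δ (φ (ψ j))) ∧
          ((-(x j) + (pv j).1, (pv j).2) : HexVertex) ∉ Nf (δ (φ (ψ j)))) := by
  -- the pinned gate columns and the spliced columns
  obtain ⟨G₀, hG₀s, hG₀ab, hG₀lim, -, -⟩ := exists_spliced_gateColumn hsanti hspos (E.pt 0)
    (fun j => (q (φ (ψ₀ j))).1 - x j) habove0 hconv0
  obtain ⟨G₁, hG₁s, hG₁ab, hG₁lim, -, -⟩ := exists_spliced_gateColumn hsanti hspos (E.pt 1)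
    (fun j => (q' (φ (ψ₀ j))).1 - x j) habove1 hconv1
  -- as a `Fin 2`-indexed column
  obtain ⟨g, hg0, hg1⟩ : ∃ g : Fin 2 → ℝ → Site 2, g 0 = G₀ ∧ g 1 = G₁ := ⟨![G₀, G₁], rfl, rfl⟩
  have habove : ∀ i (δ' : ℝ), 0 < δ' → (E.pt i).im < ((δ' : ℂ) * hexCenter ((g i δ', 0) : HexVertex)).im := by
    refine Fin.forall_fin_two.2 ⟨fun δ' hδ' => ?_, fun δ' hδ' => ?_⟩
    · rw [hg0]; exact hG₀ab δ' hδ'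
    · rw [hg1]; exact hG₁ab δ' hδ'
  have hglim : ∀ i, Tendsto (fun δ' : ℝ => (δ' : ℂ) * hexCenter ((g i δ', 0) : HexVertex)) (𝓝[>] 0)
      (𝓝 (E.pt i)) := by
    refine Fin.forall_fin_two.2 ⟨?_, ?_⟩
    · rw [hg0]; exact hG₀lim
    · rw [hg1]; exact hG₁lim
  have hgq : ∀ j, x j + g 0 (δ (φ (ψ₀ j))) = (q (φ (ψ₀ j))).1 := by
    intro j; rw [hg0, hG₀s]; abel
  have hgq' : ∀ j, x j + g 1 (δ (φ (ψ₀ j))) = (q' (φ (ψ₀ j))).1 := by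
    intro j; rw [hg1, hG₁s]; abel
  have hg0row : ∀ j, g 0 (δ (φ (ψ₀ j))) 1 = (q (φ (ψ₀ j))).1 1 - x j 1 := by
    intro j; rw [hg0, hG₀s]; simp
  have hg1row : ∀ j, g 1 (δ (φ (ψ₀ j))) 1 = (q' (φ (ψ₀ j))).1 1 - x j 1 := by
    intro j; rw [hg1, hG₁s]; simp
  -- the nested families
  obtain ⟨N, Λ', a, b, ρ', ha, hb, hρ', hρ'F, hpt, hflatE', hflatM', hadm, hfamM, hexhE, hexhM,
    hlimE0, hlimE1, hlimM0, hlimM1, hdepth, hclosed, hfaces⟩ :=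
    twoPiece_nested_families E M hM hflat hB hρc hρc' hρF hFc hFc' hFw hsep habove hglim
  -- the cells
  have hq_eq : ∀ j, q (φ (ψ₀ j)) = ((x j + g 0 (δ (φ (ψ₀ j))), 0) : HexVertex) := fun j =>
    upFace_eq (hq0 j) _ (hgq j).symm
  have hq'_eq : ∀ j, q' (φ (ψ₀ j)) = ((x j + g 1 (δ (φ (ψ₀ j))), 0) : HexVertex) := fun j =>
    upFace_eq (hq1 j) _ (hgq' j).symm
  have hglim_seq : ∀ i, Tendsto (fun j => ((δ (φ (ψ₀ j)) : ℝ) : ℂ) *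
      hexCenter ((g i (δ (φ (ψ₀ j))), 0) : HexVertex)) atTop (𝓝 (E.pt i)) := fun i =>
    (hglim i).comp hs0
  have hinM : ∀ᶠ δ' : ℝ in 𝓝[>] 0, (hexGraph.induce (↑(Λ' δ') : Set HexVertex)).Preconnected ∧
      ∀ v ∈ Λ' δ', (δ' : ℂ) * hexCenter v ∈ M.carrier :=
    hfamM.mono fun δ' h => ⟨h.2.2.2.2.1, h.2.2.2.2.2.1⟩
  have hrows : ∀ᶠ δ' : ℝ in 𝓝[>] 0, ∀ (i : Fin 2) (v : HexVertex),
      (δ' : ℂ) * hexCenter v ∈ ball (E.pt i) ρ' → (v ∈ Λ' δ' ↔ g i δ' 1 ≤ v.1 1) := by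
    filter_upwards [hfamM] with δ' h i v hv
    exact h.2.2.2.2.2.2 i v (by rw [hpt i]; exact hv)
  have hU : ∀ᶠ j in atTop, ∀ (i : Fin 2) (v : HexVertex),
      ((δ (φ (ψ₀ j)) : ℝ) : ℂ) * hexCenter v - ((δ (φ (ψ₀ j)) : ℝ) : ℂ) * triEmbed (x j) ∈ ball (E.pt i) ρ' →
        (v ∈ S (φ (ψ₀ j)) (n (φ (ψ₀ j))) ∪ T (φ (ψ₀ j)) (n' (φ (ψ₀ j))) ↔
          v.1 1 < x j 1 + g i (δ (φ (ψ₀ j))) 1) := by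
    filter_upwards [hU0, hU1] with j h0 h1
    refine Fin.forall_fin_two.2 ⟨fun v hv => ?_, fun v hv => ?_⟩
    · rw [hg0row, h0 v (ball_subset_ball (by linarith) hv)]
      constructor <;> intro h <;> linarith
    · rw [hg1row, h1 v (ball_subset_ball (by linarith) hv)]
      constructor <;> intro h <;> linarith
  have hreach' : ∀ᶠ j in atTop, ∀ (w : HexVertex)
      (π : (hexDomainGraph D.carrier (δ (φ (ψ₀ j)))).Walk (q (φ (ψ₀ j))) w),
      (∀ y ∈ π.support, y ∉ S (φ (ψ₀ j)) (n (φ (ψ₀ j))) ∪ T (φ (ψ₀ j)) (n' (φ (ψ₀ j)))) →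
        ∀ y ∈ π.support, ((-(x j) + y.1, y.2) : HexVertex) ∈
          {u : HexVertex | ((δ (φ (ψ₀ j)) : ℝ) : ℂ) * hexCenter u ∈ E.carrier ∧
            closedBall (((δ (φ (ψ₀ j)) : ℝ) : ℂ) * hexCenter u) (25 * δ (φ (ψ₀ j))) ⊆ E.carrier ∪
              ⋃ i, {z : ℂ | |z.re - (E.pt i).re| ≤ ρc ∧ (E.pt i).im - 30 * δ (φ (ψ₀ j)) ≤ z.im ∧
                z.im ≤ (E.pt i).im} ∧
            ∀ i, |(((δ (φ (ψ₀ j)) : ℝ) : ℂ) * hexCenter u).re - (E.pt i).re| < ρc + 10 * δ (φ (ψ₀ j)) →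
              |(((δ (φ (ψ₀ j)) : ℝ) : ℂ) * hexCenter u).im - (E.pt i).im| < ρc' →
                g i (δ (φ (ψ₀ j))) 1 ≤ u.1 1} := by
    filter_upwards [hreach] with j h w π hπ y hy
    obtain ⟨hyE, hdisc, hz0, hz1⟩ := h w π hπ y hy
    show _ ∧ _ ∧ _
    rw [smul_hexCenter_neg_translate]
    have hrow : ((-(x j) + y.1) : Site 2) 1 = -(x j 1) + y.1 1 := by simp
    refine ⟨hyE, hdisc, Fin.forall_fin_two.2 ⟨fun hre him => ?_, fun hre him => ?_⟩⟩
    · rw [hrow, hg0row]; linarith [hz0 hre him]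
    · rw [hrow, hg1row]; linarith [hz1 hre him]
  obtain ⟨Λ'', hmem, hcells⟩ := squeeze_cells (Ω := D.carrier) E M (U := fun j =>
      S (φ (ψ₀ j)) (n (φ (ψ₀ j))) ∪ T (φ (ψ₀ j)) (n' (φ (ψ₀ j))))
    (q := fun j => q (φ (ψ₀ j))) (q' := fun j => q' (φ (ψ₀ j)))
    (p := fun j => ((x j + (g 0 (δ (φ (ψ₀ j))) - Pi.single 1 1), 1) : HexVertex))
    (p' := fun j => ((x j + (g 1 (δ (φ (ψ₀ j))) - Pi.single 1 1), 1) : HexVertex))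
    hs0 hρ' hρc hq_eq (fun j => rfl) hq'_eq (fun j => rfl) hglim_seq ha hb hinM hrows
    (hdepth.mono fun δ' h v hv => (h v hv).1) hclosed hfaces hU hMD (hMU ρ' hρ') hreach' hqdom
  -- the index where everything holds
  obtain ⟨J, hJ⟩ := eventually_atTop.1 (hcells.and hprob)
  refine ⟨fun j => ψ₀ (J + j), M, τ, ρ', Λ', fun i δ' => g i δ' 1, a, b, fun j => x (J + j),
    fun j => Λ'' (J + j), fun j => ((x (J + j) + (g 0 (δ (φ (ψ₀ (J + j)))) - Pi.single 1 1), 1) : HexVertex),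
    fun j => ((x (J + j) + (g 1 (δ (φ (ψ₀ (J + j)))) - Pi.single 1 1), 1) : HexVertex),
    fun i j hij => hψ₀ (by omega), hbd, hbd0, hbd1, ⟨hρ', hflatM'⟩, ?_, hexhM, hlimM0, hlimM1, ?_, ?_,
    E, ρ', φE, Φ, d, N, fun δ' => g 0 δ' 1, fun δ' => g 1 δ' 1, fun δ' => g 1 δ' 1, ⟨hρ', hflatE'⟩,
    hM, hφE, hΦ, hd, hlev, ?_, hexhE, hexhM, hlimE0, hlimE1, ?_⟩
  · exact hfamM
  · exact hτ.comp (tendsto_atTop_atTop.2 fun b => ⟨b, fun a ha => by omega⟩)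
  · intro j
    obtain ⟨⟨h1, h2, h3, h4, h5, h6, h7, h8, h9, -, -, -⟩, -⟩ := hJ (J + j) (by omega)
    exact ⟨hmem (J + j), h1, h2, h3, h4, h5, h6, h7, h8, h9⟩
  · exact hadm
  · refine Eventually.of_forall fun j => ?_
    obtain ⟨⟨h1, h2, h3, h4, h5, h6, h7, h8, h9, h10, h11, h12⟩, hP⟩ := hJ (J + j) (by omega)
    exact ⟨hP, hmem (J + j), h1, h2, h3, h4, h5, h6, h7, h8, h9, h10, h11, h12⟩

end Summit.CriticalPhenomena.SAWScalingLimit.Theorems.ObservableToSLE.TypeLadder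

end
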